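import Summits.KontsevichZagierPeriods.Zeta5Search.Barrier.ConeGammaTranslateJunctions

/-!
# ζ(5) search — BARRIER: THE CLOSED-ORBIT LIMIT — on the coherence ball the per-period signed jump masses of the translated
# orbit ARE the canonical chamber weights of the cusp, termwise (`J_k(δ) = W_k(δ)`); the derivative of the translate integral is
# the canonical chamber functional; the cusp slope is that derivative (file (2) of «THE CLOSED-ORBIT LIMIT»)

HONEST FRAMING (cell `pub-zeta5`): systematic search; no irrationality claim unless kernel-certified. MODEL objects
under Brown–Zudilin's (28)+(30) accounting ([BZ22] = arXiv:2210.03391; (28) observed, not proved); nothing here is a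
statement about `ζ(5)`, any `γ` of record, the cone's supremum (C2 OPEN) or the value / sign of any jump mass, chamber weight,
derivative or cusp slope at a named direction (DATA of the cell); NO cancellation is quantified; S-E / (TD_A) stay CONJECTURED;
records in print UNMOVED. Prover P2 g41 (item «THE CLOSED-ORBIT LIMIT» = P2 g40's successor menu (b), file (2); plan INBOX
2026-08-28). Sources: P2 g40 `ConeGammaTranslateGradient` / `ConeGammaTranslateGeneric` (THE GRADIENT THEOREM: at a translate `δ`
with a margin, `P = translateIntegral a T` is Fréchet-differentiable with `fderiv ℝ P δ Δ = Σ_k (φ_k(Δ)/h_k(a))·J_k(δ)`), P2 g33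
`ConeGammaCuspPeriodCanonical` (THE CHAMBER FORMULA: `cuspSlope a T δ' = Σ_k W_k(δ₀)·φ_k(δ')/h_k(a)` for `δ'` in the closed
chamber of a generic `δ₀`, `W_k(δ₀) = F(P≤(k)) − F(P<(k))` the CANONICAL chamber weights), file (1) `ConeGammaTranslateJunctions`.

With the SETTING of file (1) (all 28 forms positive, `T > 0` a period, margin `r`, coherence `|ρ_k| ≤ ρ̄`,
`(2ρ̄ + r/2)·x_max < min(1, wallDist a T)`; `ρ_k = φ_k(δ)/h_k(a)`; `F` the canonical period pattern function):
* **`jumpMass_eq_canonical_weight` — THE CLOSED-ORBIT LIMIT, TERMWISE**: for EVERY form `k`,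
  **`J_k(δ) = F({l : ρ_k ≤ ρ_l}) − F({l : ρ_k < ρ_l}) = W_k(δ)`** (file (1)'s junction marginals summed over one period: the
  crossing window against the member junctions, non-members contributing `0`) — P2 g40's gradient of `P` at a coherent generic
  translate IS P2 g33's chamber-weight vector of the chamber of `δ`: the descriptions of the cusp at `ρ > 0` (translates) and at
  `ρ → 0⁺` (the germ) are ONE statement, and the limit is ATTAINED on the whole coherent chamber, not only approached;
* **`jumpMass_eq_of_same_chamber`** — `J` is CONSTANT on each open chamber of the rate arrangement inside the coherence ball (same
  rate order ⇒ same 28 jump masses; in particular scale-free, `J_k(ε·δ) = J_k(δ)`);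
* **`fderiv_translateIntegral_eq_chamber`** — `fderiv ℝ P δ Δ = Σ_k W_k(δ)·φ_k(Δ)/h_k(a)` for EVERY `Δ ∈ ℝ⁸`: THE DERIVATIVE OF THE
  TRANSLATE INTEGRAL AT A COHERENT GENERIC TRANSLATE IS THE CANONICAL CHAMBER FUNCTIONAL;
* **`cuspSlope_eq_fderiv_translateIntegral`** — **`cuspSlope a T δ' = fderiv ℝ P δ δ'` for every `δ'` in the closed chamber of `δ`**,
  in particular `cuspSlope a T δ = fderiv ℝ P δ δ` (`cuspSlope_self_eq_fderiv`: EULER'S IDENTITY for the conical germ — the cusp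
  slope is the radial derivative of `P` read anywhere on the coherent chamber); `translateIntegral_sub_eq_cuspSlope_sub` —
  `P(δ + Δ) − P(δ) = σ(δ + Δ) − σ(δ)` for `|φ_kΔ| ≤ r·h_k/4`: on the coherent chamber `P` and `σ` have the same linear part;
* margin-free forms: `exists_margin_of_coherent` (pairwise distinct non-zero rates with `ρ̄·x_max < 1`, `2T·x_max²·ρ̄ < 1` ⇒ a
  margin exists, by P2 g40's `exists_margin_of_generic`), **`fderiv_translateIntegral_eq_chamber_of_coherent`**,
  **`cuspSlope_eq_fderiv_of_coherent`** — the two identities above with ONLY «pairwise distinct non-zero rates, `3ρ̄·x_max < min(1,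
  wallDist a T)`, `2T·x_max²·ρ̄ < 1`» as hypotheses on `δ`.
NOT here (honest): any value of `J = W`, of the derivative or of `σ` at a named direction (DATA); the radius of the coherence
ball at a named direction (DATA); the cells of the translate arrangement away from the closed orbit; `Φ`, `γ`, C2, S-E, `ζ(5)`.
-/

noncomputable section

open Set MeasureTheory Finset
open scoped Topology

namespace Summit.KontsevichZagierPeriods.Zeta5Search.Barrier.ConeGamma

/-! ### THE CLOSED-ORBIT LIMIT: the jump masses are the canonical chamber weights -/

/-- **THE CLOSED-ORBIT LIMIT, TERMWISE — `J_k(δ) = W_k(δ)`.** All 28 forms of `a` positive, `T > 0` a period, `F` the canonical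
period pattern function (`F(A) = Σ_{m<#bkpts−1} patternN a b_m A`). Let the translate `δ` have a margin `r > 0` (`hsep`, `hend`)
and be COHERENT: `|φ_k(δ)/h_k(a)| ≤ ρ̄` with `(2ρ̄ + r/2)·x_max(a) < 1` and `< wallDist a T`. Then for EVERY form `k` the
per-period signed jump mass of P2 g40's gradient theorem IS P2 g33's canonical chamber weight of the chamber of `δ`:
`Σ_{z ∈ S_k} (𝒩(θ_{s_{k,z}}) − 𝒩(θ_{s_{k,z} − r/2})) = F({l : ρ_k ≤ ρ_l}) − F({l : ρ_k < ρ_l})`, `ρ_l = φ_l(δ)/h_l(a)`.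
(So `Σ_k J_k = 0` and the oriented box bounds of the two files are one fact, and the lane's `J_e` tables at small translates
are the `W` tables — DATA, in no statement.) -/
theorem jumpMass_eq_canonical_weight {a : Dir} (hpos : ∀ k, 0 < h28 a k) {T : ℝ} (hT : 0 < T)
    (hper : ∀ k : Fin 28, ∃ z : ℤ, T * h28 a k = z) {F : Finset (Fin 28) → ℝ}
    (hF : ∀ A, F A = ∑ m ∈ Finset.range ((bkpts a T).card - 1), ((patternN a (bkpt a T m) A : ℤ) : ℝ))
    {δ : Fin 8 → ℝ} {r : ℝ} (hr : 0 < r)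
    (hsep : ∀ (k k' : Fin 28) (z z' : ℤ), (k ≠ k' ∨ z ≠ z') →
      r ≤ |((z : ℝ) - phiForm δ k) / h28 a k - ((z' : ℝ) - phiForm δ k') / h28 a k'|)
    (hend : ∀ (k : Fin 28) (z : ℤ), r ≤ |((z : ℝ) - phiForm δ k) / h28 a k|)
    {ρb : ℝ} (hρ : ∀ k, |phiForm δ k / h28 a k| ≤ ρb) (hc1 : (2 * ρb + r / 2) * xMax a < 1)
    (hc2 : (2 * ρb + r / 2) * xMax a < wallDist a T) (k : Fin 28) :
    ((∑ z ∈ Finset.Ioc ⌊phiForm δ k⌋ (⌊phiForm δ k⌋ + ⌊T * h28 a k⌋),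
        (torusN ((((z : ℝ) - phiForm δ k) / h28 a k) • sParam a + δ) -
          torusN ((((z : ℝ) - phiForm δ k) / h28 a k - r / 2) • sParam a + δ)) : ℤ) : ℝ) =
      F (Finset.univ.filter fun l => phiForm δ k / h28 a k ≤ phiForm δ l / h28 a l) -
        F (Finset.univ.filter fun l => phiForm δ k / h28 a k < phiForm δ l / h28 a l) := by
  classical
  have hk := hpos k
  have hx : 0 < xMax a := xMax_pos hpos
  obtain ⟨N, hN⟩ := hper k
  have hNf : ⌊T * h28 a k⌋ = N := by rw [hN, Int.floor_intCast]
  have hN0 : 0 ≤ N := by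
    have : (0 : ℝ) ≤ N := by rw [← hN]; exact (mul_pos hT hk).le
    exact_mod_cast this
  -- the two rate sets
  set A : Finset (Fin 28) := Finset.univ.filter fun l => phiForm δ k / h28 a k ≤ phiForm δ l / h28 a l with hA
  set B : Finset (Fin 28) := Finset.univ.filter fun l => phiForm δ k / h28 a k < phiForm δ l / h28 a l with hB
  -- `|φ_k δ| < 1`, `φ_k δ ≠ 0`
  have hρk : |phiForm δ k| < 1 := by
    have h1 : |phiForm δ k| = h28 a k * |phiForm δ k / h28 a k| := by
      rw [abs_div, abs_of_pos hk]; field_simp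
    rw [h1]
    have h2 := hρ k
    have h3 := le_xMax a k
    have h4 : 0 ≤ ρb := (abs_nonneg _).trans (hρ k)
    calc h28 a k * |phiForm δ k / h28 a k| ≤ xMax a * ρb := mul_le_mul h3 h2 (abs_nonneg _) hx.le
      _ < 1 := by nlinarith
  have hρk0 : phiForm δ k ≠ 0 := by
    intro h
    have h' := rate_abs_of_margin hend k
    rw [h, zero_div, abs_zero] at h'
    exact absurd h' (not_le.mpr hr)
  -- step 1: termwise, the jumps are the canonical marginals
  have step1 : ((∑ z ∈ Finset.Ioc ⌊phiForm δ k⌋ (⌊phiForm δ k⌋ + ⌊T * h28 a k⌋),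
      (torusN ((((z : ℝ) - phiForm δ k) / h28 a k) • sParam a + δ) -
        torusN ((((z : ℝ) - phiForm δ k) / h28 a k - r / 2) • sParam a + δ)) : ℤ) : ℝ) =
      ∑ z ∈ Finset.Ioc ⌊phiForm δ k⌋ (⌊phiForm δ k⌋ + N),
        (((patternN a ((z : ℝ) / h28 a k) A : ℤ) : ℝ) - ((patternN a ((z : ℝ) / h28 a k) B : ℤ) : ℝ)) := by
    rw [hNf]
    push_cast
    refine Finset.sum_congr rfl fun z hz => ?_
    rw [Finset.mem_Ioc] at hz
    have hfl : -1 ≤ ⌊phiForm δ k⌋ := by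
      have : (-1 : ℝ) < phiForm δ k := by linarith [(abs_lt.mp hρk).1]
      have h := Int.floor_le_floor this.le
      rw [show ((-1 : ℝ)) = ((-1 : ℤ) : ℝ) by norm_num, Int.floor_intCast] at h
      exact h
    have hfu : ⌊phiForm δ k⌋ ≤ 0 := by
      have : phiForm δ k < 1 := (abs_lt.mp hρk).2
      have h := Int.floor_le_floor this.le
      rw [show ((1 : ℝ)) = ((1 : ℤ) : ℝ) by norm_num, Int.floor_intCast] at h
      have h' : ⌊phiForm δ k⌋ ≠ 1 := by
        intro h1
        have := Int.floor_eq_iff.mp h1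
        push_cast at this
        linarith [this.1]
      omega
    have hz0 : 0 ≤ z := by omega
    have hzN : z ≤ N := by omega
    have hzT : (z : ℝ) / h28 a k ≤ T := by
      rw [div_le_iff₀ hk, hN]; exact_mod_cast hzN
    have h := jump_eq_patternN_marginal hpos hr hsep hρ hc1 hc2 k hz0 hzT
    exact_mod_cast h
  -- step 2: the crossing window is the standard window (periodicity of `patternN`)
  have step2 : ∑ z ∈ Finset.Ioc ⌊phiForm δ k⌋ (⌊phiForm δ k⌋ + N),
        (((patternN a ((z : ℝ) / h28 a k) A : ℤ) : ℝ) - ((patternN a ((z : ℝ) / h28 a k) B : ℤ) : ℝ)) =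
      ∑ z ∈ Finset.Ico (0 : ℤ) N,
        (((patternN a ((z : ℝ) / h28 a k) A : ℤ) : ℝ) - ((patternN a ((z : ℝ) / h28 a k) B : ℤ) : ℝ)) := by
    refine sum_Ioc_floor_eq_sum_Ico hρk hρk0 hN0
      (fun z : ℤ => (((patternN a ((z : ℝ) / h28 a k) A : ℤ) : ℝ) - ((patternN a ((z : ℝ) / h28 a k) B : ℤ) : ℝ))) ?_
    have eT : ((N : ℤ) : ℝ) / h28 a k = 0 + T := by rw [← hN, zero_add, mul_div_cancel_right₀ _ hk.ne']
    have e0 : (((0 : ℤ) : ℝ)) / h28 a k = 0 := by simp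
    simp only [eT, e0, patternN_add_period a hper]
  -- step 3: the standard window is the member-junction sum, and non-members contribute nothing
  have step3 : ∑ m ∈ Finset.range ((bkpts a T).card - 1),
      (((patternN a (bkpt a T m) A : ℤ) : ℝ) - ((patternN a (bkpt a T m) B : ℤ) : ℝ)) =
      ∑ z ∈ Finset.Ico (0 : ℤ) N,
        (((patternN a ((z : ℝ) / h28 a k) A : ℤ) : ℝ) - ((patternN a ((z : ℝ) / h28 a k) B : ℤ) : ℝ)) := by
    rw [sum_range_bkpt_eq_sum_filter_member k
      (g := fun b => ((patternN a b A : ℤ) : ℝ) - ((patternN a b B : ℤ) : ℝ)) ?_]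
    · exact sum_member_junctions_eq_sum_Ico hpos hT k hN
        (fun b => ((patternN a b A : ℤ) : ℝ) - ((patternN a b B : ℤ) : ℝ))
    · intro m _ hnon
      rw [sub_eq_zero, Int.cast_inj]
      refine patternN_congr fun l hl => ?_
      have hlk : l ≠ k := by rintro rfl; obtain ⟨z, hz⟩ := hl; exact hnon z hz
      rw [hA, hB]
      simp only [Finset.mem_filter, Finset.mem_univ, true_and]
      have hne := rate_ne_of_margin hr hsep k l (Ne.symm hlk)
      exact ⟨fun h => lt_of_le_of_ne h hne, le_of_lt⟩
  rw [step1, step2, ← step3, hF A, hF B, ← Finset.sum_sub_distrib]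

/-- **`J_k` IS CONSTANT ON EACH OPEN CHAMBER OF THE RATE ARRANGEMENT (inside the coherence ball).** Two coherent translates
`δ`, `δ'` with margins `r`, `r'` and the SAME rate order (`ρ_k(δ) < ρ_l(δ) ↔ ρ_k(δ') < ρ_l(δ')` for all `k, l`) have the
same 28 per-period signed jump masses — in particular `δ' = ε·δ`, `0 < ε ≤ 1`: the jump masses are scale-free down to the
closed orbit, where they become the chamber weights of the cusp (the «closed-orbit limit» is attained, not only approached). -/
theorem jumpMass_eq_of_same_chamber {a : Dir} (hpos : ∀ k, 0 < h28 a k) {T : ℝ} (hT : 0 < T)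
    (hper : ∀ k : Fin 28, ∃ z : ℤ, T * h28 a k = z)
    {δ : Fin 8 → ℝ} {r : ℝ} (hr : 0 < r)
    (hsep : ∀ (k k' : Fin 28) (z z' : ℤ), (k ≠ k' ∨ z ≠ z') →
      r ≤ |((z : ℝ) - phiForm δ k) / h28 a k - ((z' : ℝ) - phiForm δ k') / h28 a k'|)
    (hend : ∀ (k : Fin 28) (z : ℤ), r ≤ |((z : ℝ) - phiForm δ k) / h28 a k|)
    {ρb : ℝ} (hρ : ∀ k, |phiForm δ k / h28 a k| ≤ ρb) (hc1 : (2 * ρb + r / 2) * xMax a < 1)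
    (hc2 : (2 * ρb + r / 2) * xMax a < wallDist a T)
    {δ' : Fin 8 → ℝ} {r' : ℝ} (hr' : 0 < r')
    (hsep' : ∀ (k k' : Fin 28) (z z' : ℤ), (k ≠ k' ∨ z ≠ z') →
      r' ≤ |((z : ℝ) - phiForm δ' k) / h28 a k - ((z' : ℝ) - phiForm δ' k') / h28 a k'|)
    (hend' : ∀ (k : Fin 28) (z : ℤ), r' ≤ |((z : ℝ) - phiForm δ' k) / h28 a k|)
    {ρb' : ℝ} (hρ' : ∀ k, |phiForm δ' k / h28 a k| ≤ ρb') (hc1' : (2 * ρb' + r' / 2) * xMax a < 1)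
    (hc2' : (2 * ρb' + r' / 2) * xMax a < wallDist a T)
    (hord : ∀ k l : Fin 28, phiForm δ k / h28 a k < phiForm δ l / h28 a l ↔
      phiForm δ' k / h28 a k < phiForm δ' l / h28 a l) (k : Fin 28) :
    ∑ z ∈ Finset.Ioc ⌊phiForm δ k⌋ (⌊phiForm δ k⌋ + ⌊T * h28 a k⌋),
        (torusN ((((z : ℝ) - phiForm δ k) / h28 a k) • sParam a + δ) -
          torusN ((((z : ℝ) - phiForm δ k) / h28 a k - r / 2) • sParam a + δ)) =
      ∑ z ∈ Finset.Ioc ⌊phiForm δ' k⌋ (⌊phiForm δ' k⌋ + ⌊T * h28 a k⌋),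
        (torusN ((((z : ℝ) - phiForm δ' k) / h28 a k) • sParam a + δ') -
          torusN ((((z : ℝ) - phiForm δ' k) / h28 a k - r' / 2) • sParam a + δ')) := by
  classical
  obtain ⟨F, hF⟩ : ∃ F : Finset (Fin 28) → ℝ,
      ∀ A, F A = ∑ m ∈ Finset.range ((bkpts a T).card - 1), ((patternN a (bkpt a T m) A : ℤ) : ℝ) := ⟨_, fun _ => rfl⟩
  have h1 := jumpMass_eq_canonical_weight hpos hT hper hF hr hsep hend hρ hc1 hc2 k
  have h2 := jumpMass_eq_canonical_weight hpos hT hper hF hr' hsep' hend' hρ' hc1' hc2' k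
  have eB : (Finset.univ.filter fun l => phiForm δ k / h28 a k < phiForm δ l / h28 a l) =
      Finset.univ.filter fun l => phiForm δ' k / h28 a k < phiForm δ' l / h28 a l :=
    Finset.filter_congr fun l _ => hord k l
  have eA : (Finset.univ.filter fun l => phiForm δ k / h28 a k ≤ phiForm δ l / h28 a l) =
      Finset.univ.filter fun l => phiForm δ' k / h28 a k ≤ phiForm δ' l / h28 a l := by
    refine Finset.filter_congr fun l _ => ?_
    rw [← not_lt, ← not_lt, hord l k]
  rw [eA, eB, ← h2] at h1
  exact_mod_cast h1

/-! ### The derivative of the translate integral is the canonical chamber functional -/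

/-- **THE DERIVATIVE OF `P` AT A COHERENT GENERIC TRANSLATE IS THE CANONICAL CHAMBER FUNCTIONAL.** Under the hypotheses of
`jumpMass_eq_canonical_weight`: `P = translateIntegral a T` is Fréchet-differentiable at `δ` and for EVERY `Δ ∈ ℝ⁸`
`fderiv ℝ P δ Δ = Σ_k (F({l : ρ_k ≤ ρ_l}) − F({l : ρ_k < ρ_l}))·φ_k(Δ)/h_k(a)` (P2 g40's `differentiableAt_translateIntegral` with
the jump masses replaced by the chamber weights). -/
theorem fderiv_translateIntegral_eq_chamber {a : Dir} (hpos : ∀ k, 0 < h28 a k) {T : ℝ} (hT : 0 < T)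
    (hper : ∀ k : Fin 28, ∃ z : ℤ, T * h28 a k = z) {F : Finset (Fin 28) → ℝ}
    (hF : ∀ A, F A = ∑ m ∈ Finset.range ((bkpts a T).card - 1), ((patternN a (bkpt a T m) A : ℤ) : ℝ))
    {δ : Fin 8 → ℝ} {r : ℝ} (hr : 0 < r)
    (hsep : ∀ (k k' : Fin 28) (z z' : ℤ), (k ≠ k' ∨ z ≠ z') →
      r ≤ |((z : ℝ) - phiForm δ k) / h28 a k - ((z' : ℝ) - phiForm δ k') / h28 a k'|)
    (hend : ∀ (k : Fin 28) (z : ℤ), r ≤ |((z : ℝ) - phiForm δ k) / h28 a k|)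
    {ρb : ℝ} (hρ : ∀ k, |phiForm δ k / h28 a k| ≤ ρb) (hc1 : (2 * ρb + r / 2) * xMax a < 1)
    (hc2 : (2 * ρb + r / 2) * xMax a < wallDist a T) :
    DifferentiableAt ℝ (translateIntegral a T) δ ∧ ∀ Δ : Fin 8 → ℝ, fderiv ℝ (translateIntegral a T) δ Δ =
      ∑ k, (F (Finset.univ.filter fun l => phiForm δ k / h28 a k ≤ phiForm δ l / h28 a l) -
          F (Finset.univ.filter fun l => phiForm δ k / h28 a k < phiForm δ l / h28 a l)) *
        (phiForm Δ k / h28 a k) := by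
  obtain ⟨hd, hf⟩ := differentiableAt_translateIntegral hpos hT hper hr hsep hend
  refine ⟨hd, fun Δ => ?_⟩
  rw [hf Δ]
  refine Finset.sum_congr rfl fun k _ => ?_
  rw [jumpMass_eq_canonical_weight hpos hT hper hF hr hsep hend hρ hc1 hc2 k, mul_comm]

/-- **THE CUSP SLOPE IS THE DERIVATIVE OF `P` ALONG THE CHAMBER.** Under the same hypotheses, for every displacement `δ'` in the
CLOSED chamber of `δ` (`ρ_k(δ') < ρ_l(δ') ⇒ ρ_k(δ) < ρ_l(δ)`): **`cuspSlope a T δ' = fderiv ℝ P δ δ'`** — P2 g33's chamber formula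
and P2 g40's gradient theorem are one statement (the rates of `δ` are pairwise distinct by the margin, `rate_ne_of_margin`). -/
theorem cuspSlope_eq_fderiv_translateIntegral {a : Dir} (hpos : ∀ k, 0 < h28 a k) {T : ℝ} (hT : 0 < T)
    (hper : ∀ k : Fin 28, ∃ z : ℤ, T * h28 a k = z)
    {δ : Fin 8 → ℝ} {r : ℝ} (hr : 0 < r)
    (hsep : ∀ (k k' : Fin 28) (z z' : ℤ), (k ≠ k' ∨ z ≠ z') →
      r ≤ |((z : ℝ) - phiForm δ k) / h28 a k - ((z' : ℝ) - phiForm δ k') / h28 a k'|)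
    (hend : ∀ (k : Fin 28) (z : ℤ), r ≤ |((z : ℝ) - phiForm δ k) / h28 a k|)
    {ρb : ℝ} (hρ : ∀ k, |phiForm δ k / h28 a k| ≤ ρb) (hc1 : (2 * ρb + r / 2) * xMax a < 1)
    (hc2 : (2 * ρb + r / 2) * xMax a < wallDist a T) (δ' : Fin 8 → ℝ)
    (href : ∀ k l : Fin 28, phiForm δ' k / h28 a k < phiForm δ' l / h28 a l →
      phiForm δ k / h28 a k < phiForm δ l / h28 a l) :
    cuspSlope a T δ' = fderiv ℝ (translateIntegral a T) δ δ' := by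
  classical
  obtain ⟨F, hF⟩ : ∃ F : Finset (Fin 28) → ℝ,
      ∀ A, F A = ∑ m ∈ Finset.range ((bkpts a T).card - 1), ((patternN a (bkpt a T m) A : ℤ) : ℝ) := ⟨_, fun _ => rfl⟩
  rw [(fderiv_translateIntegral_eq_chamber hpos hT hper hF hr hsep hend hρ hc1 hc2).2 δ',
    cuspSlope_eq_greedy_canonical_of_refines hpos hT hper hF (rate_ne_of_margin hr hsep) δ' href]

/-- **EULER'S IDENTITY FOR THE CONICAL GERM**: `cuspSlope a T δ = fderiv ℝ P δ δ` — the cusp slope in the direction `δ` is the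
radial derivative of the translate integral at the coherent generic translate `δ` itself. -/
theorem cuspSlope_self_eq_fderiv {a : Dir} (hpos : ∀ k, 0 < h28 a k) {T : ℝ} (hT : 0 < T)
    (hper : ∀ k : Fin 28, ∃ z : ℤ, T * h28 a k = z)
    {δ : Fin 8 → ℝ} {r : ℝ} (hr : 0 < r)
    (hsep : ∀ (k k' : Fin 28) (z z' : ℤ), (k ≠ k' ∨ z ≠ z') →
      r ≤ |((z : ℝ) - phiForm δ k) / h28 a k - ((z' : ℝ) - phiForm δ k') / h28 a k'|)
    (hend : ∀ (k : Fin 28) (z : ℤ), r ≤ |((z : ℝ) - phiForm δ k) / h28 a k|)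
    {ρb : ℝ} (hρ : ∀ k, |phiForm δ k / h28 a k| ≤ ρb) (hc1 : (2 * ρb + r / 2) * xMax a < 1)
    (hc2 : (2 * ρb + r / 2) * xMax a < wallDist a T) :
    cuspSlope a T δ = fderiv ℝ (translateIntegral a T) δ δ :=
  cuspSlope_eq_fderiv_translateIntegral hpos hT hper hr hsep hend hρ hc1 hc2 δ fun _ _ h => h

/-- **ON THE COHERENT CHAMBER `P` AND `σ` HAVE THE SAME LINEAR PART**: for every `Δ` with `|φ_k(Δ)| ≤ r·h_k(a)/4`,
`P(δ + Δ) − P(δ) = cuspSlope a T (δ + Δ) − cuspSlope a T δ` (such a `Δ` keeps `δ + Δ` in the closed chamber of `δ`: the rates of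
`δ` are `r`-separated, `rate_sep_of_margin`, and move by at most `r/4`). -/
theorem translateIntegral_sub_eq_cuspSlope_sub {a : Dir} (hpos : ∀ k, 0 < h28 a k) {T : ℝ} (hT : 0 < T)
    (hper : ∀ k : Fin 28, ∃ z : ℤ, T * h28 a k = z)
    {δ : Fin 8 → ℝ} {r : ℝ} (hr : 0 < r)
    (hsep : ∀ (k k' : Fin 28) (z z' : ℤ), (k ≠ k' ∨ z ≠ z') →
      r ≤ |((z : ℝ) - phiForm δ k) / h28 a k - ((z' : ℝ) - phiForm δ k') / h28 a k'|)
    (hend : ∀ (k : Fin 28) (z : ℤ), r ≤ |((z : ℝ) - phiForm δ k) / h28 a k|)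
    {ρb : ℝ} (hρ : ∀ k, |phiForm δ k / h28 a k| ≤ ρb) (hc1 : (2 * ρb + r / 2) * xMax a < 1)
    (hc2 : (2 * ρb + r / 2) * xMax a < wallDist a T)
    {Δ : Fin 8 → ℝ} (hΔ : ∀ k, |phiForm Δ k| ≤ r * h28 a k / 4) :
    translateIntegral a T (δ + Δ) - translateIntegral a T δ = cuspSlope a T (δ + Δ) - cuspSlope a T δ := by
  obtain ⟨hd, hf⟩ := differentiableAt_translateIntegral hpos hT hper hr hsep hend
  -- `δ + Δ` is refined by `δ`
  have href : ∀ k l : Fin 28, phiForm (δ + Δ) k / h28 a k < phiForm (δ + Δ) l / h28 a l →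
      phiForm δ k / h28 a k < phiForm δ l / h28 a l := by
    intro k l h
    rw [phiForm_add, phiForm_add, add_div, add_div] at h
    by_contra hle
    push Not at hle
    have hkl : k ≠ l := by rintro rfl; exact absurd h (lt_irrefl _)
    have hs := rate_sep_of_margin hsep hkl
    rw [abs_of_nonneg (by linarith)] at hs
    have h1 : |phiForm Δ k / h28 a k| ≤ r / 4 := by
      rw [abs_div, abs_of_pos (hpos k), div_le_iff₀ (hpos k)]; linarith [hΔ k]
    have h2 : |phiForm Δ l / h28 a l| ≤ r / 4 := by
      rw [abs_div, abs_of_pos (hpos l), div_le_iff₀ (hpos l)]; linarith [hΔ l]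
    have h1' := (abs_le.mp h1).1
    have h2' := (abs_le.mp h2).2
    linarith
  rw [cuspSlope_eq_fderiv_translateIntegral hpos hT hper hr hsep hend hρ hc1 hc2 (δ + Δ) href,
    cuspSlope_self_eq_fderiv hpos hT hper hr hsep hend hρ hc1 hc2, map_add, add_sub_cancel_left,
    translateIntegral_sub_eq_sum_jumpMass hpos hT hper hr hsep hend hΔ, hf Δ]

/-! ### Margin-free forms: coherent generic translates -/

/-- **A COHERENT GENERIC TRANSLATE HAS A MARGIN.** All forms positive, `T > 0` a period; if the rates of `δ` are pairwise distinct
and non-zero and `|ρ_k| ≤ ρ̄` with `ρ̄·x_max(a) < 1` and `2T·x_max(a)²·ρ̄ < 1`, then `δ` lies off the walls `φ_kδ ∈ ℤ` and the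
resonances `T·h_{k'}φ_kδ − T·h_kφ_{k'}δ ∈ ℤ` (both quantities are non-zero and `< 1` in size), so P2 g40's
`exists_margin_of_generic` supplies a margin — which may be taken `≤ 2ρ̄`. -/
theorem exists_margin_of_coherent {a : Dir} (hpos : ∀ k, 0 < h28 a k) {T : ℝ} (hT : 0 < T)
    (hper : ∀ k : Fin 28, ∃ z : ℤ, T * h28 a k = z) {δ : Fin 8 → ℝ}
    (hgen : ∀ k l : Fin 28, k ≠ l → phiForm δ k / h28 a k ≠ phiForm δ l / h28 a l)
    (hnz : ∀ k, phiForm δ k ≠ 0) {ρb : ℝ} (hρ : ∀ k, |phiForm δ k / h28 a k| ≤ ρb) (hc0 : ρb * xMax a < 1)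
    (hc3 : 2 * T * xMax a ^ 2 * ρb < 1) :
    ∃ r : ℝ, 0 < r ∧ r ≤ 2 * ρb ∧
      (∀ (k k' : Fin 28) (z z' : ℤ), (k ≠ k' ∨ z ≠ z') →
        r ≤ |((z : ℝ) - phiForm δ k) / h28 a k - ((z' : ℝ) - phiForm δ k') / h28 a k'|) ∧
      (∀ (k : Fin 28) (z : ℤ), r ≤ |((z : ℝ) - phiForm δ k) / h28 a k|) := by
  have hx : 0 < xMax a := xMax_pos hpos
  have hρb : 0 < ρb := by
    have h1 : 0 < |phiForm δ 0 / h28 a 0| := abs_pos.mpr (div_ne_zero (hnz 0) (hpos 0).ne')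
    exact h1.trans_le (hρ 0)
  -- a real number of size `< 1` which is an integer is `0`
  have hint : ∀ {x : ℝ}, |x| < 1 → x ≠ 0 → ∀ z : ℤ, x ≠ z := by
    intro x hx1 hx0 z hz
    rw [hz] at hx1 hx0
    have h1 : |(z : ℝ)| < 1 := hx1
    rw [← Int.cast_abs] at h1
    have h2 : |z| < 1 := by exact_mod_cast h1
    have h3 : z = 0 := Int.abs_lt_one_iff.mp h2
    exact hx0 (by rw [h3]; simp)
  have hφ : ∀ k, |phiForm δ k| ≤ ρb * h28 a k := fun k => by
    have h := hρ k
    rw [abs_div, abs_of_pos (hpos k), div_le_iff₀ (hpos k)] at h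
    exact h
  have hwall : ∀ (k : Fin 28) (z : ℤ), phiForm δ k ≠ z := fun k => by
    refine hint ?_ (hnz k)
    calc |phiForm δ k| ≤ ρb * h28 a k := hφ k
      _ ≤ ρb * xMax a := mul_le_mul_of_nonneg_left (le_xMax a k) hρb.le
      _ < 1 := hc0
  have hres : ∀ (k k' : Fin 28), k ≠ k' → ∀ z : ℤ,
      T * h28 a k' * phiForm δ k - T * h28 a k * phiForm δ k' ≠ z := fun k k' hkk' => by
    have e : T * h28 a k' * phiForm δ k - T * h28 a k * phiForm δ k' =
        T * h28 a k * h28 a k' * (phiForm δ k / h28 a k - phiForm δ k' / h28 a k') := by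
      field_simp [(hpos k).ne', (hpos k').ne']
    refine hint ?_ ?_
    · rw [e, abs_mul, abs_of_pos (by have := hpos k; have := hpos k'; positivity)]
      have h1 : |phiForm δ k / h28 a k - phiForm δ k' / h28 a k'| ≤ 2 * ρb := by
        have := abs_sub (phiForm δ k / h28 a k) (phiForm δ k' / h28 a k'); linarith [hρ k, hρ k']
      have h2 : T * h28 a k * h28 a k' ≤ T * xMax a * xMax a := by
        have := le_xMax a k; have := le_xMax a k'; have := hpos k; have := hpos k'
        gcongr
      calc T * h28 a k * h28 a k' * |phiForm δ k / h28 a k - phiForm δ k' / h28 a k'| ≤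
          T * xMax a * xMax a * (2 * ρb) :=
            mul_le_mul h2 h1 (abs_nonneg _) (by positivity)
        _ = 2 * T * xMax a ^ 2 * ρb := by ring
        _ < 1 := hc3
    · rw [e]
      exact mul_ne_zero (by have := hpos k; have := hpos k'; positivity) (sub_ne_zero.mpr (hgen k k' hkk'))
  obtain ⟨r, hr, hsep, hend⟩ := exists_margin_of_generic hpos hT hper hwall hres
  refine ⟨min r (2 * ρb), lt_min hr (by linarith), min_le_right _ _, fun k k' z z' h =>
    (min_le_left _ _).trans (hsep k k' z z' h), fun k z => (min_le_left _ _).trans (hend k z)⟩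

/-- **THE DERIVATIVE IS THE CHAMBER FUNCTIONAL — margin-free form.** All 28 forms of `a` positive, `T > 0` a period, `F` the
canonical period pattern function; `δ` with pairwise distinct non-zero rates, `|ρ_k| ≤ ρ̄`, `3ρ̄·x_max < 1`, `3ρ̄·x_max < wallDist a T`,
`2T·x_max²·ρ̄ < 1`. Then `P` is differentiable at `δ` with `fderiv ℝ P δ Δ = Σ_k W_k(δ)·φ_k(Δ)/h_k(a)` for every `Δ`. -/
theorem fderiv_translateIntegral_eq_chamber_of_coherent {a : Dir} (hpos : ∀ k, 0 < h28 a k) {T : ℝ} (hT : 0 < T)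
    (hper : ∀ k : Fin 28, ∃ z : ℤ, T * h28 a k = z) {F : Finset (Fin 28) → ℝ}
    (hF : ∀ A, F A = ∑ m ∈ Finset.range ((bkpts a T).card - 1), ((patternN a (bkpt a T m) A : ℤ) : ℝ))
    {δ : Fin 8 → ℝ} (hgen : ∀ k l : Fin 28, k ≠ l → phiForm δ k / h28 a k ≠ phiForm δ l / h28 a l)
    (hnz : ∀ k, phiForm δ k ≠ 0) {ρb : ℝ} (hρ : ∀ k, |phiForm δ k / h28 a k| ≤ ρb) (hc1 : 3 * ρb * xMax a < 1)
    (hc2 : 3 * ρb * xMax a < wallDist a T) (hc3 : 2 * T * xMax a ^ 2 * ρb < 1) :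
    DifferentiableAt ℝ (translateIntegral a T) δ ∧ ∀ Δ : Fin 8 → ℝ, fderiv ℝ (translateIntegral a T) δ Δ =
      ∑ k, (F (Finset.univ.filter fun l => phiForm δ k / h28 a k ≤ phiForm δ l / h28 a l) -
          F (Finset.univ.filter fun l => phiForm δ k / h28 a k < phiForm δ l / h28 a l)) *
        (phiForm Δ k / h28 a k) := by
  have hx : 0 < xMax a := xMax_pos hpos
  have hρb : 0 ≤ ρb := (abs_nonneg _).trans (hρ 0)
  obtain ⟨r, hr, hr2, hsep, hend⟩ :=
    exists_margin_of_coherent hpos hT hper hgen hnz hρ (by nlinarith) hc3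
  have hc : (2 * ρb + r / 2) * xMax a ≤ 3 * ρb * xMax a := by nlinarith
  exact fderiv_translateIntegral_eq_chamber hpos hT hper hF hr hsep hend hρ (hc.trans_lt hc1) (hc.trans_lt hc2)

/-- **THE CUSP SLOPE IS THE DERIVATIVE — margin-free form**: under the same hypotheses on `δ`, for every `δ'` in the closed chamber
of `δ`, `cuspSlope a T δ' = fderiv ℝ P δ δ'`; in particular `cuspSlope a T δ = fderiv ℝ P δ δ`. -/
theorem cuspSlope_eq_fderiv_of_coherent {a : Dir} (hpos : ∀ k, 0 < h28 a k) {T : ℝ} (hT : 0 < T)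
    (hper : ∀ k : Fin 28, ∃ z : ℤ, T * h28 a k = z)
    {δ : Fin 8 → ℝ} (hgen : ∀ k l : Fin 28, k ≠ l → phiForm δ k / h28 a k ≠ phiForm δ l / h28 a l)
    (hnz : ∀ k, phiForm δ k ≠ 0) {ρb : ℝ} (hρ : ∀ k, |phiForm δ k / h28 a k| ≤ ρb) (hc1 : 3 * ρb * xMax a < 1)
    (hc2 : 3 * ρb * xMax a < wallDist a T) (hc3 : 2 * T * xMax a ^ 2 * ρb < 1) (δ' : Fin 8 → ℝ)
    (href : ∀ k l : Fin 28, phiForm δ' k / h28 a k < phiForm δ' l / h28 a l →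
      phiForm δ k / h28 a k < phiForm δ l / h28 a l) :
    cuspSlope a T δ' = fderiv ℝ (translateIntegral a T) δ δ' ∧
      cuspSlope a T δ = fderiv ℝ (translateIntegral a T) δ δ := by
  have hx : 0 < xMax a := xMax_pos hpos
  have hρb : 0 ≤ ρb := (abs_nonneg _).trans (hρ 0)
  obtain ⟨r, hr, hr2, hsep, hend⟩ :=
    exists_margin_of_coherent hpos hT hper hgen hnz hρ (by nlinarith) hc3
  have hc : (2 * ρb + r / 2) * xMax a ≤ 3 * ρb * xMax a := by nlinarith
  exact ⟨cuspSlope_eq_fderiv_translateIntegral hpos hT hper hr hsep hend hρ (hc.trans_lt hc1) (hc.trans_lt hc2) δ' href,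
    cuspSlope_self_eq_fderiv hpos hT hper hr hsep hend hρ (hc.trans_lt hc1) (hc.trans_lt hc2)⟩

end Summit.KontsevichZagierPeriods.Zeta5Search.Barrier.ConeGamma

end
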